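import Mathlib
import HarnessLib
import Summits.HubbardSuperconductivity.HubbardSuperconductivity.Theorems.KLProgrammeThermalGreenMatsubaraWordAllU

/-!
# Child `KLRegimeVolumeLimitV12` (stmt-HubbardSuperconductivity-19858), stub `stub_vl_bound`: the Grassmann half of input (P2) of
# `stub_vl_bound_of_pointwise_limits` — pointwise all-`U` limits of the position two-point numerator on `[0,β)` (k3c5-p2's
# `…allU_time`) packaged with the `M`-eventual sup bound on `[0,β]` UNIFORM in the site and the time (seat hubbard-kl-k3c4-p2, g3)

`…VolumeLimitTwoPointFourierGlue.stub_vl_bound_of_pointwise_limits` (k3c5-p3) asks, besides the six-point input (P6)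
(`…VolumeLimitSixPointWordAllU`), for (P2): a pointwise-in-`s ∈ [0,β)` limit `Pinf x s` of
`∫dμ_{C_M} ψ⁺_{(x,s)↑} ψ⁻_{(0,0)↑} e^{−V}` for every site `x`, an eventual sup bound `C₂` on `[0,β]` uniform in `(x, s)`, and (P3) a bound on
the Fourier–Matsubara transform of `Pinf` (which needs the Hamiltonian identification (H1), k3c5-p1).  This file supplies the first two with the
EXPLICIT limit of k3c5-p2's `tendsto_gaussExpect_twoPoint_mul_grassmannExp_allU_time` (so that (H1), stated as a `HasSum` for that very series,
rewrites `Pinf` directly):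

* `twoPoint_sup_bound_allU` — `∃ C, ∀ᶠ M, ∀ x, ∀ s ∈ [0,β], ‖∫dμ_{C_M} ψ⁺_{(x,s)σ} ψ⁻_{(y,s_y)σ'} e^{−V}‖ ≤ C` (the general pair-word machine
  `exists_uniform_bound_gaussExpect_word_allU` with one pair, constants free of the external data; finitely many sites);
* **`twoPoint_pointwise_and_bound_allU`** — (P2)'s two Grassmann clauses with `Pinf x s :=` the limit-determinant series at external times
  `(s, 0)`, sites `(x, 0)`, spins `(0, 0)`.

Everything is proved; no definition; every real `U`, every `L ≥ 1`, `β > 0`.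
-/

namespace Summit.HubbardSuperconductivity.HubbardSuperconductivity.Theorems.MatsubaraAllU

set_option linter.dupNamespace false -- summit = problem name (single-conjunct summit), D-0017

open MeasureTheory Finset Filter Topology Literature.MathematicalPhysics.QuantumLattice
  Literature.Probability.LatticeModels
open Literature.MathematicalPhysics.QuantumLattice.GrassmannAlgebra
open scoped Nat ComplexOrder

noncomputable section

variable {L : ℕ} [NeZero L]

/-- **Eventual sup bound of the position two-point numerator, uniform in the site and the time, for EVERY coupling**: for `β > 0`, spins
`σ, σ'`, a fixed second point `(y, s_y)` with `s_y ∈ [0,β]`: `∃ C, ∀ᶠ M, ∀ x, ∀ s ∈ [0,β], ‖∫dμ_{C_M} ψ⁺_{(x,s)σ} ψ⁻_{(y,s_y)σ'} e^{−V}‖ ≤ C`. -/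
theorem twoPoint_sup_bound_allU {β : ℝ} (hβ : 0 < β) (U μ : ℝ) (σ σ' : Fin 2) (ye : TorusSite 2 L) {sy : ℝ}
    (hsy : sy ∈ Set.Icc (0 : ℝ) β) :
    ∃ C : ℝ, ∀ᶠ M : ℕ in atTop, ∀ (xe : TorusSite 2 L), ∀ s ∈ Set.Icc (0 : ℝ) β,
      ‖gaussExpect ℂ (hubbardCovariance L M β μ 0)
        (positionField L M β 0 σ xe s * positionField L M β 1 σ' ye sy * grassmannExp (-(hubbardInteraction L M β U)))‖ ≤ C := by
  classical
  set Pe : Fin 1 → Fin 2 × Fin 2 := ![((0 : Fin 2), σ)] with hPe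
  set Qe : Fin 1 → Fin 2 × Fin 2 := ![((1 : Fin 2), σ')] with hQe
  have hPe_inj : Function.Injective Pe := Function.injective_of_subsingleton _
  have hQe_inj : Function.Injective Qe := Function.injective_of_subsingleton _
  have hword : ∀ (M : ℕ) (xe : TorusSite 2 L) (s : ℝ),
      positionField L M β 0 σ xe s * positionField L M β 1 σ' ye sy * grassmannExp (-(hubbardInteraction L M β U)) =
        (List.ofFn fun l : Fin 1 => positionField L M β 0 (Pe l).2 ((![xe, ye] : Fin 2 → TorusSite 2 L) (Pe l).1)
            ((![s, sy] : Fin 2 → ℝ) (Pe l).1) *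
          positionField L M β 1 (Qe l).2 ((![xe, ye] : Fin 2 → TorusSite 2 L) (Qe l).1) ((![s, sy] : Fin 2 → ℝ) (Qe l).1)).prod *
          grassmannExp (-(hubbardInteraction L M β U)) := by
    intro M xe s
    simp [hPe, hQe]
  have hseI : ∀ s ∈ Set.Icc (0 : ℝ) β, ∀ p : Fin 2, (![s, sy] : Fin 2 → ℝ) p ∈ Set.Icc (0 : ℝ) β := by
    intro s hs p
    fin_cases p
    · simpa using hs
    · simpa using hsy
  choose Cz hCz0 Mz hMz using fun xe : TorusSite 2 L =>
    exists_uniform_bound_gaussExpect_word_allU (L := L) hβ μ U (![xe, ye] : Fin 2 → TorusSite 2 L) Pe Qe hPe_inj hQe_inj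
  obtain ⟨C, hC⟩ := Finite.exists_le Cz
  obtain ⟨M₀, hM₀⟩ := Finite.exists_le Mz
  refine ⟨C, ?_⟩
  filter_upwards [eventually_ge_atTop M₀] with M hM xe s hs
  rw [hword]
  exact (hMz xe M ((hM₀ xe).trans hM) _ (hseI s hs)).trans (hC xe)

/-- **Input (P2) of `stub_vl_bound_of_pointwise_limits`, Grassmann half, for EVERY coupling** (`β > 0`, any `U, μ`, `L ≥ 1`): the position
two-point numerator `∫dμ_{C_M} ψ⁺_{(x,s)↑}ψ⁻_{(0,0)↑}e^{−V}` converges for every site `x` and every `s ∈ [0,β)` to the limit-determinant series of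
k3c5-p2's `tendsto_gaussExpect_twoPoint_mul_grassmannExp_allU_time` at external times `(s, 0)` (written out: this is the `Pinf` to feed, so that
k3c5-p1's (H1) `HasSum` identifies it), AND is eventually bounded on `[0,β]` uniformly in `(x, s)`. -/
theorem twoPoint_pointwise_and_bound_allU {β : ℝ} (hβ : 0 < β) (U μ : ℝ) :
    (∀ x : TorusSite 2 L, ∀ s ∈ Set.Ico (0 : ℝ) β, Tendsto (fun M : ℕ =>
        gaussExpect ℂ (hubbardCovariance L M β μ 0)
          (positionField L M β 0 0 x s * positionField L M β 1 0 0 0 * grassmannExp (-(hubbardInteraction L M β U))))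
        atTop (𝓝 (∑' n : ℕ, ((-1 : ℂ) ^ n * ((n ! : ℂ))⁻¹) * ((U : ℂ) ^ n * ∑ xv : Fin n → TorusSite 2 L,
          ∫ τ in Set.Icc (0 : Fin n → ℝ) (fun _ => β),
            (Matrix.of fun i j : Fin (n * 2 + 1) =>
              vertexLimitEntry L β μ ((Fin.append xv ![x, 0] : Fin (n + 2) → TorusSite 2 L) (twoPointPlusEnum n 0 i).1)
                ((Fin.append xv ![x, 0] : Fin (n + 2) → TorusSite 2 L) (twoPointMinusEnum n 0 j).1)
                (twoPointPlusEnum n 0 i).2 (twoPointMinusEnum n 0 j).2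
                ((Fin.append τ ![s, 0] : Fin (n + 2) → ℝ) (twoPointMinusEnum n 0 j).1 -
                  (Fin.append τ ![s, 0] : Fin (n + 2) → ℝ) (twoPointPlusEnum n 0 i).1)).det)))) ∧
    ∃ C₂ : ℝ, ∀ᶠ M : ℕ in atTop, ∀ (x : TorusSite 2 L), ∀ s ∈ Set.Icc (0 : ℝ) β,
      ‖gaussExpect ℂ (hubbardCovariance L M β μ 0)
        (positionField L M β 0 0 x s * positionField L M β 1 0 0 0 * grassmannExp (-(hubbardInteraction L M β U)))‖ ≤ C₂ := by
  refine ⟨fun x s hs => ?_, twoPoint_sup_bound_allU hβ U μ 0 0 0 (Set.left_mem_Icc.2 hβ.le)⟩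
  exact tendsto_gaussExpect_twoPoint_mul_grassmannExp_allU_time hβ μ U 0 0 x 0 hs (Set.left_mem_Ico.2 hβ)

end

end Summit.HubbardSuperconductivity.HubbardSuperconductivity.Theorems.MatsubaraAllU
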